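import Summits.BirchSwinnertonDyer.BirchSwinnertonDyer.Theorems.KolyvaginDepthDoorRingClassTowerTransversals
import Summits.BirchSwinnertonDyer.BirchSwinnertonDyer.Theorems.KolyvaginRoadThreeLevelData
import Literature.NumberTheory.EllipticCurves.HeegnerPointsOfConductorRationalityProofs
import Literature.NumberTheory.EllipticCurves.RingClassGalOverCyclicProofs
import Mathlib.FieldTheory.AlgebraicClosure
import HarnessLib

/-!
# Route `KolyvaginDepthDoor`, crux `KolyvaginDepthSupply` (stmt-BirchSwinnertonDyer-21765) —
# THE COMPATIBLE SYSTEM OF KOLYVAGIN–HEEGNER DATA ON ALL SQUARE-FREE INERT LEVELS, PART 3: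
# the system itself, UNCONDITIONAL, extending any given datum

Helper file (`--supports stmt-BirchSwinnertonDyer-21765 --as helper`); it closes nothing and BSD is
not proved by it.

The hF-free / twist-free doors and row kits of this route (`…KolyvaginDepthSupplyDoorOfSystem`,
`…DoorNoTwistOfPrint`, `…DepthTableRowKitNoTwist`) and the definition `KolyvaginDepthSupplySystem`
take as INPUT a system `d n : KolyvaginHeegnerData Dt β ι n` COMPATIBLE along the ring class tower
(binders `hσ`, `hS₁`, `hS₂`, `hemb`: McCallum's one system of choices, as required by the named fact
`McCallum1991.prop44_localOrder_kolyvaginClass_mul_eq`). This file PROVES that such a system exists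
on every square-free level with inert prime factors (the levels `S(M)` of every `(E, p)` at once) and
that it can be chosen THROUGH any given datum `d₀` at one such level:

* `exists_kolyvaginHeegnerSystem_extending` — for `K` imaginary quadratic with `d_K < −4` and the
  Heegner hypothesis for `N`, a frame `(Dt, β, ι)` and a datum `d₀` at a square-free inert level `n₀`:
  a system `d n` (all square-free inert `n`) with `d n₀ = d₀`, compatible in `(σ, S, emb)` for EVERY
  pair `m ∣ n`.

Consequently the system binder of the doors is DISCHARGED and the bit `c_M(n₁) ≠ 0` may be read at ANY
datum of level `n₁` (sequel `…KolyvaginDepthSupplyDoorOfDatum`). Inputs, all theorems of the tree: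
`phi_heegnerPointOfConductor_mem_range_map_ringClassField_holds` (`y(n) ∈ E(K[n])`, Gross §3 / Darmon
Thm. 3.6), `exists_generator_ringClassGalOver_holds` (`G_ℓ` cyclic), X11b's ring class tower
(`RingClassTowerRestriction`, `KolyvaginRingClassCardinality`), PARTS 1–2 of this series. Note on
currency: the existing doors quantify `d : ∀ n : ℕ, KolyvaginHeegnerData Dt β ι n` over ALL `n`
(including `n = 0` and levels meeting `N`, where no datum is known to exist); the system here lives
on the good levels only, which is all the descent uses.

THEOREMS ONLY (no definition, no named fact, no `sorry`), unconditional.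

References: [GrossLMS1991] B. H. Gross, *Kolyvagin's work on modular elliptic curves*, LMS LNS 153
(1991), §3 (p. 238: "the point `x_n` is rational over `K_n`"; p. 239: "`G_n ≃ ∏ G_ℓ` … Let `σ_ℓ` be a
fixed generator of `G_ℓ`"), §4 ((4.1): "Let `S` be a set of coset representatives for `G_n` in
`𝒢_n`"); [McCallumLMS1991] W. G. McCallum, *Kolyvagin's work on Shafarevich–Tate groups*, ibid., §4
(one system `σ_l`, `S`, `K̄` behind `P_n`, `c_M(n)`, Prop. 4.4); [Darmon2004] Thm. 3.6.
-/

set_option linter.dupNamespace false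

noncomputable section

open scoped Classical
open Field NumberField Module
open Literature.NumberTheory.EllipticCurves Literature.NumberTheory.EllipticCurves.RingClassField
open Literature.NumberTheory.EllipticCurves.ModularForms
open Literature.NumberTheory.QuadraticFields Literature.NumberTheory.QuadraticFields.RingClass
open Summit.BirchSwinnertonDyer.Rank1Residual.X11b.RingClassTower

namespace Summit.BirchSwinnertonDyer.BirchSwinnertonDyer.Theorems.KolyvaginDepthDoor

variable {K : Type} [Field K] [NumberField K]

/-! ## §6 The compatible system of Kolyvagin–Heegner data, extending a given datum -/

/-- **THE COMPATIBLE KOLYVAGIN–HEEGNER SYSTEM.** Let `E/ℚ` be elliptic with model `W`, `K` imaginary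
quadratic with `d_K < −4` satisfying the Heegner hypothesis for `N`, `(Dt, β, ι)` a frame, and
`d₀ : KolyvaginHeegnerData Dt β ι n₀` ONE datum at a square-free level `n₀` with inert prime factors.
Then there is a system `d n` of Kolyvagin–Heegner data at EVERY square-free level `n` with inert
prime factors, with `d n₀ = d₀`, which is COMPATIBLE along the whole tower: for all such `m ∣ n`,
the generators `σ_q` (`q ∣ m`) of `d n` restrict to those of `d m`, the transversal of `d n` restricts
ONTO that of `d m`, and the embeddings `K[n] → K̄`, `K[m] → K̄` agree on `K[m] ⊆ K[n]` — McCallum's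
"one system of choices" (LMS LN 153, §4: `σ_l` "a fixed generator", `S` "a set of coset
representatives", `Res` along one `K̄`), i.e. exactly the compatibility binders of
`McCallum1991.prop44_localOrder_kolyvaginClass_mul_eq` and of this route's `…DoorOfSystem` /
`KolyvaginDepthSupplySystem`, for EVERY pair of levels at once. UNCONDITIONAL: the points
`y(n) ∈ E(K[n])` are `phi_heegnerPointOfConductor_mem_range_map_ringClassField_holds`, the prime-level
generators `exists_generator_ringClassGalOver_holds`; the construction is limit-free — `σ_q` at level
`n` := the unique lift of a generator fixed once at level `q` (`existsUnique_lift_ringClassGalOver_prime`),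
`S` at level `n` := the fibre product of transversals fixed once at the prime levels
(`existsUnique_transversal_of_prime_transversals`), `emb` := one `K`-embedding of the algebraic
closure of `K` in `ℂ`, restricted — the prime-level choices and the embedding being read off `d₀`.
[cite: GrossLMS1991, §3 (p. 239: σ_ℓ a fixed generator of G_ℓ), §4 ((4.1): S, Res)]
[cite: McCallumLMS1991, §4 (S_r(M), P_n, c_M(n); proof of Prop. 4.4, p. 302)] -/
theorem exists_kolyvaginHeegnerSystem_extending {N : ℕ} [NeZero N] {W : WeierstrassCurve ℚ}
    [W.IsElliptic] (hK : IsImaginaryQuadratic K) (hd4 : NumberField.discr K < -4)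
    (hH : SatisfiesHeegnerHypothesis N K) (Dt : ModularParametrizationData W N) (β : ℤ)
    (ι : K →+* ℂ) {n₀ : ℕ} (hn₀ : Squarefree n₀)
    (hin₀ : ∀ q ∈ n₀.primeFactors, (Ideal.span {(q : 𝓞 K)}).IsPrime)
    (d₀ : KolyvaginHeegnerData Dt β ι n₀) :
    ∃ d : ∀ n : ℕ, Squarefree n → (∀ q ∈ n.primeFactors, (Ideal.span {(q : 𝓞 K)}).IsPrime) →
        KolyvaginHeegnerData Dt β ι n,
      d n₀ hn₀ hin₀ = d₀ ∧
      ∀ (m n : ℕ) (hm : Squarefree m)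
        (him : ∀ q ∈ m.primeFactors, (Ideal.span {(q : 𝓞 K)}).IsPrime) (hn : Squarefree n)
        (hin : ∀ q ∈ n.primeFactors, (Ideal.span {(q : 𝓞 K)}).IsPrime), m ∣ n →
        (∀ q ∈ m.primeFactors, ∀ (x : ringClassField K ι m) (x' : ringClassField K ι n),
          (x : ℂ) = x' → (((d n hn hin).σ q x' : ringClassField K ι n) : ℂ) =
            ((d m hm him).σ q x : ℂ)) ∧
        (∀ s ∈ (d m hm him).S, ∃ s' ∈ (d n hn hin).S, ∀ (x : ringClassField K ι m)
          (x' : ringClassField K ι n), (x : ℂ) = x' →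
            ((s' x' : ringClassField K ι n) : ℂ) = (s x : ℂ)) ∧
        (∀ s' ∈ (d n hn hin).S, ∃ s ∈ (d m hm him).S, ∀ (x : ringClassField K ι m)
          (x' : ringClassField K ι n), (x : ℂ) = x' →
            ((s' x' : ringClassField K ι n) : ℂ) = (s x : ℂ)) ∧
        (∀ (x : ringClassField K ι m) (x' : ringClassField K ι n), (x : ℂ) = x' →
          (d n hn hin).emb x' = (d m hm him).emb x) := by
  classical
  letI : Algebra K ℂ := ι.toAlgebra
  have hn₀0 : n₀ ≠ 0 := Squarefree.ne_zero hn₀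
  have hβ : (4 * N : ℤ) ∣ β ^ 2 - NumberField.discr K := d₀.dvd_sq_sub
  have h1 := phi_heegnerPointOfConductor_mem_range_map_ringClassField_holds N W K
  -- (R) restriction homomorphisms for every pair of levels `m ∣ n`, `n ≠ 0`
  have hR_ex : ∀ m n : ℕ,
      ∃ r : ringClassGal ι n →* (ringClassField K ι m ≃ₐ[ℚ] ringClassField K ι m),
        m ∣ n → n ≠ 0 → ∀ (g : ringClassGal ι n) (x : ringClassField K ι m) (y : ringClassField K ι n),
          (x : ℂ) = (y : ℂ) → ((r g x : ringClassField K ι m) : ℂ) =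
            (((g : ringClassField K ι n ≃ₐ[ℚ] ringClassField K ι n) y : ringClassField K ι n) : ℂ) := by
    intro m n
    by_cases hmn : m ∣ n ∧ n ≠ 0
    · obtain ⟨r, hr⟩ := exists_restrictHom hK ι hmn.1 hmn.2
      exact ⟨r, fun _ _ => hr⟩
    · exact ⟨1, fun h h' => (hmn ⟨h, h'⟩).elim⟩
  choose R hR using hR_ex
  -- (g⁰) generators at the prime levels, read off `d₀` at the primes of `n₀`
  have hσ₀G : ∀ q ∈ n₀.primeFactors, d₀.σ q ∈ ringClassGal ι n₀ := fun q hq =>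
    ringClassGalOver_le_ringClassGal ι n₀ (n₀ / q)
      (by rw [← d₀.zpowers_σ q hq]; exact Subgroup.mem_zpowers _)
  have hg_ex : ∀ q : ℕ, ∃ g : ringClassField K ι q ≃ₐ[ℚ] ringClassField K ι q,
      (q.Prime → (Ideal.span {(q : 𝓞 K)}).IsPrime →
        Subgroup.zpowers g = ringClassGalOver ι q 1) ∧
      (∀ hq : q ∈ n₀.primeFactors, g = R q n₀ ⟨d₀.σ q, hσ₀G q hq⟩) := by
    intro q
    by_cases hq : q ∈ n₀.primeFactors
    · refine ⟨R q n₀ ⟨d₀.σ q, hσ₀G q hq⟩, fun _ _ => ?_, fun _ => rfl⟩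
      exact zpowers_restrict_eq_ringClassGalOver_one hK ι hn₀ hq
        (hR q n₀ (Nat.dvd_of_mem_primeFactors hq) hn₀0) (hσ₀G q hq) (d₀.zpowers_σ q hq)
    · by_cases hp : q.Prime ∧ (Ideal.span {(q : 𝓞 K)}).IsPrime
      · obtain ⟨g, hg⟩ := exists_generator_ringClassGalOver_holds hK ι q q hp.1.prime.squarefree
          hp.1 (dvd_refl q) hp.2
        rw [Nat.div_self hp.1.pos] at hg
        exact ⟨g, fun _ _ => hg, fun h => (hq h).elim⟩
      · exact ⟨1, fun h h' => (hp ⟨h, h'⟩).elim, fun h => (hq h).elim⟩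
  choose g₀ hg₀ hg₀' using hg_ex
  -- (S⁰) transversals at the prime levels, read off `d₀` at the primes of `n₀`
  have hS_ex : ∀ q : ℕ, ∃ S : Finset (ringClassField K ι q ≃ₐ[ℚ] ringClassField K ι q),
      (q.Prime → (Ideal.span {(q : 𝓞 K)}).IsPrime →
        ∀ h ∈ ringClassGal ι q, ∃! s, s ∈ S ∧ h⁻¹ * s ∈ ringClassGalOver ι q 1) ∧
      (∀ hq : q ∈ n₀.primeFactors, ∀ s', s' ∈ S ↔
        ∃ (s : _) (hs : s ∈ d₀.S), R q n₀ ⟨s, d₀.S_subset s hs⟩ = s') := by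
    intro q
    by_cases hq : q ∈ n₀.primeFactors
    · refine ⟨(d₀.S.attach).image (fun s => R q n₀ ⟨s.1, d₀.S_subset s.1 s.2⟩), fun _ _ h hh => ?_,
        fun _ s' => ?_⟩
      · have hmem : ∀ s', s' ∈ (d₀.S.attach).image (fun s => R q n₀ ⟨s.1, d₀.S_subset s.1 s.2⟩) ↔
            ∃ (s : _) (hs : s ∈ d₀.S), R q n₀ ⟨s, d₀.S_subset s hs⟩ = s' := fun s' => by
          simp only [Finset.mem_image, Finset.mem_attach, true_and, Subtype.exists]
        have hu := existsUnique_restrict_transversal hK ι (Nat.dvd_of_mem_primeFactors hq) hn₀0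
          (hR q n₀ (Nat.dvd_of_mem_primeFactors hq) hn₀0) d₀.S_subset d₀.S_transversal hh
        obtain ⟨s', ⟨hs'₁, hs'₂⟩, huniq⟩ := hu
        exact ⟨s', ⟨(hmem s').mpr hs'₁, hs'₂⟩, fun t ht => huniq t ⟨(hmem t).mp ht.1, ht.2⟩⟩
      · simp only [Finset.mem_image, Finset.mem_attach, true_and, Subtype.exists]
    · by_cases hp : q.Prime ∧ (Ideal.span {(q : 𝓞 K)}).IsPrime
      · obtain ⟨dq⟩ := nonempty_kolyvaginHeegnerData_of_grossCM h1 exists_generator_ringClassGalOver_holds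
          hK hH Dt β ι hβ hp.1.prime.squarefree (fun p hp' => by
            rw [hp.1.primeFactors, Finset.mem_singleton] at hp'; rw [hp']; exact hp.2)
        exact ⟨dq.S, fun _ _ => dq.S_transversal, fun h => (hq h).elim⟩
      · exact ⟨∅, fun h h' => (hp ⟨h, h'⟩).elim, fun h => (hq h).elim⟩
  choose S₀ hS₀ hS₀' using hS_ex
  -- (Ω, Φ) one `K`-embedding of the algebraic closure of `K` in `ℂ`, extending `d₀.emb`
  let Ω : IntermediateField K ℂ := algebraicClosure K ℂ
  have hvalK : ∀ n : ℕ, ∃ v : ringClassField K ι n →ₐ[K] ℂ, ∀ x, v x = (x : ℂ) := fun n =>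
    ⟨{ (ringClassField K ι n).subtype with commutes' := fun _ => rfl }, fun _ => rfl⟩
  have hmemΩ : ∀ n : ℕ, n ≠ 0 → ∀ x : ringClassField K ι n, (x : ℂ) ∈ Ω := by
    intro n hn x
    haveI := (finiteDimensional_and_isGalois_ringClassField hK ι hn).1
    obtain ⟨v, hv⟩ := hvalK n
    rw [← hv x]
    exact (mem_algebraicClosure_iff).mpr ((Algebra.IsAlgebraic.isAlgebraic x).algHom v)
  have hincl : ∀ n : ℕ, n ≠ 0 → ∃ i : ringClassField K ι n →ₐ[K] Ω, ∀ x, ((i x : Ω) : ℂ) = (x : ℂ) :=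
    fun n hn =>
    ⟨{ toFun := fun x => ⟨x, hmemΩ n hn x⟩
       map_one' := rfl
       map_mul' := fun _ _ => rfl
       map_zero' := rfl
       map_add' := fun _ _ => rfl
       commutes' := fun _ => rfl }, fun _ => rfl⟩
  choose incl hincl' using hincl
  obtain ⟨Φ, hΦ⟩ : ∃ Φ : Ω →ₐ[K] AlgebraicClosure K, ∀ x : ringClassField K ι n₀,
      Φ (incl n₀ hn₀0 x) = d₀.emb x := by
    letI algΩ : Algebra (ringClassField K ι n₀) Ω := (incl n₀ hn₀0).toRingHom.toAlgebra
    letI algC : Algebra (ringClassField K ι n₀) (AlgebraicClosure K) := d₀.emb.toAlgebra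
    haveI : IsScalarTower K (ringClassField K ι n₀) Ω :=
      IsScalarTower.of_algebraMap_eq fun k => ((incl n₀ hn₀0).commutes k).symm
    haveI : IsScalarTower K (ringClassField K ι n₀) (AlgebraicClosure K) :=
      IsScalarTower.of_algebraMap_eq fun k => (d₀.emb_apply k).symm
    haveI : Algebra.IsAlgebraic (ringClassField K ι n₀) Ω :=
      Algebra.IsAlgebraic.tower_top (K := K) (ringClassField K ι n₀)
    let Φ₀ : Ω →ₐ[ringClassField K ι n₀] AlgebraicClosure K := IsAlgClosed.lift
    exact ⟨Φ₀.restrictScalars K, fun x => Φ₀.commutes x⟩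
  -- the recipe at a level `n`: the predicate satisfied by every `d n` (including `d₀` at `n₀`)
  -- (y) the points
  have hy : ∀ n : ℕ, Squarefree n → (∀ q ∈ n.primeFactors, (Ideal.span {(q : 𝓞 K)}).IsPrime) →
      ∃ P : (W.baseChange (ringClassField K ι n)).toAffine.Point,
        WeierstrassCurve.Affine.Point.map (ringClassField K ι n).subtype.toRatAlgHom P =
          heegnerPointComplexOfConductor Dt (NumberField.discr K) β n := fun n hn hin =>
    h1 hK hH Dt β ι n hβ hn.ne_zero (coprime_of_primeFactors_inert hH hn.ne_zero hin)
  -- (build) a datum with the recipe at every good level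
  have build : ∀ (n : ℕ) (hn : Squarefree n)
      (hin : ∀ q ∈ n.primeFactors, (Ideal.span {(q : 𝓞 K)}).IsPrime),
      ∃ dn : KolyvaginHeegnerData Dt β ι n,
        (∀ q ∈ n.primeFactors, ∃ hG : dn.σ q ∈ ringClassGal ι n,
          dn.σ q ∈ ringClassGalOver ι n (n / q) ∧ R q n ⟨dn.σ q, hG⟩ = g₀ q) ∧
        (∀ s, s ∈ dn.S ↔
          ∃ hs : s ∈ ringClassGal ι n, ∀ q ∈ n.primeFactors, R q n ⟨s, hs⟩ ∈ S₀ q) ∧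
        (∀ (x : ringClassField K ι n) (y : Ω), (x : ℂ) = ((y : Ω) : ℂ) → dn.emb x = Φ y) := by
    intro n hn hin
    have hn0 : n ≠ 0 := hn.ne_zero
    haveI := finite_algEquiv_ringClassField hK ι hn0
    -- σ
    have hσ_ex : ∀ q : ℕ, ∃ σ : ringClassField K ι n ≃ₐ[ℚ] ringClassField K ι n,
        ∀ hq : q ∈ n.primeFactors, ∃ hG : σ ∈ ringClassGal ι n,
          σ ∈ ringClassGalOver ι n (n / q) ∧ R q n ⟨σ, hG⟩ = g₀ q := by
      intro q
      by_cases hq : q ∈ n.primeFactors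
      · obtain ⟨hqp, hqn, -⟩ := Nat.mem_primeFactors.mp hq
        have hg₀mem : g₀ q ∈ ringClassGalOver ι q 1 := by
          rw [← hg₀ q hqp (hin q hq)]; exact Subgroup.mem_zpowers _
        obtain ⟨g, ⟨hg, hgg⟩, -⟩ := existsUnique_lift_ringClassGalOver_prime hK ι hd4 hn hin hq
          (hR q n hqn hn0) hg₀mem
        exact ⟨g, fun _ => ⟨g.2, hg, hgg⟩⟩
      · exact ⟨1, fun h => (hq h).elim⟩
    choose σ hσ using hσ_ex
    -- S
    set Sset : Set (ringClassField K ι n ≃ₐ[ℚ] ringClassField K ι n) :=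
      {s | ∃ hs : s ∈ ringClassGal ι n, ∀ q ∈ n.primeFactors, R q n ⟨s, hs⟩ ∈ S₀ q} with hSset
    have hSfin : Sset.Finite := Set.toFinite Sset
    obtain ⟨P, hP⟩ := hy n hn hin
    refine ⟨{ dvd_sq_sub := hβ
              y := P
              map_y := hP
              σ := σ
              zpowers_σ := fun q hq => ?_
              S := hSfin.toFinset
              S_subset := fun s hs => ?_
              S_transversal := fun g hg => ?_
              emb := (Φ.comp (incl n hn0)).toRingHom
              emb_apply := fun k => ?_ }, fun q hq => hσ q hq, fun s => ?_, fun x y hxy => ?_⟩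
    · obtain ⟨hG, hmem, hgg⟩ := hσ q hq
      obtain ⟨hqp, hqn, -⟩ := Nat.mem_primeFactors.mp hq
      exact zpowers_eq_ringClassGalOver_of_lift hK ι hd4 hn hin hq (hR q n hqn hn0)
        (hg₀ q hqp (hin q hq)) (g := ⟨σ q, hG⟩) hmem hgg
    · obtain ⟨hs', -⟩ := (Set.Finite.mem_toFinset hSfin).mp hs
      exact hs'
    · have hu := existsUnique_transversal_of_prime_transversals hK ι hd4 hn hin (fun q => R q n)
        (fun q hq => hR q n (Nat.dvd_of_mem_primeFactors hq) hn0) S₀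
        (fun q hq => hS₀ q (Nat.prime_of_mem_primeFactors hq) (hin q hq)) hg
      obtain ⟨s, ⟨hs₁, hs₂⟩, huniq⟩ := hu
      refine ⟨s, ⟨(Set.Finite.mem_toFinset hSfin).mpr hs₁, hs₂⟩, fun t ht => huniq t
        ⟨(Set.Finite.mem_toFinset hSfin).mp ht.1, ht.2⟩⟩
    · change Φ (incl n hn0 (algebraMap K (ringClassField K ι n) k)) = _
      rw [AlgHom.commutes, AlgHom.commutes]
    · exact Set.Finite.mem_toFinset hSfin
    · change Φ (incl n hn0 x) = Φ y
      congr 1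
      apply Subtype.ext
      rw [hincl' n hn0 x]
      exact hxy
  -- (d) the system: `d₀` at `n₀`, the built datum elsewhere
  let d : ∀ n : ℕ, Squarefree n → (∀ q ∈ n.primeFactors, (Ideal.span {(q : 𝓞 K)}).IsPrime) →
      KolyvaginHeegnerData Dt β ι n := fun n hn hin =>
    if h : n = n₀ then h ▸ d₀ else Classical.choose (build n hn hin)
  have hd₀ : d n₀ hn₀ hin₀ = d₀ := by simp only [d, dif_pos]
  -- the recipe holds at every level (at `n₀` by the choice of `g₀`, `S₀`, `Φ`)
  have hrec : ∀ (n : ℕ) (hn : Squarefree n)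
      (hin : ∀ q ∈ n.primeFactors, (Ideal.span {(q : 𝓞 K)}).IsPrime),
      (∀ q ∈ n.primeFactors, ∃ hG : (d n hn hin).σ q ∈ ringClassGal ι n,
          (d n hn hin).σ q ∈ ringClassGalOver ι n (n / q) ∧ R q n ⟨(d n hn hin).σ q, hG⟩ = g₀ q) ∧
        (∀ s, s ∈ (d n hn hin).S ↔
          ∃ hs : s ∈ ringClassGal ι n, ∀ q ∈ n.primeFactors, R q n ⟨s, hs⟩ ∈ S₀ q) ∧
        (∀ (x : ringClassField K ι n) (y : Ω), (x : ℂ) = ((y : Ω) : ℂ) →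
          (d n hn hin).emb x = Φ y) := by
    intro n hn hin
    by_cases h : n = n₀
    · subst h
      rw [hd₀]
      refine ⟨fun q hq => ⟨hσ₀G q hq, ?_, (hg₀' q hq).symm⟩, fun s => ?_, fun x y hxy => ?_⟩
      · rw [← d₀.zpowers_σ q hq]; exact Subgroup.mem_zpowers _
      · constructor
        · intro hs
          refine ⟨d₀.S_subset s hs, fun q hq => (hS₀' q hq _).mpr ⟨s, hs, rfl⟩⟩
        · rintro ⟨hsG, hsq⟩
          -- `s` and its `d₀.S`-representative `s₁` have the same restriction to every `K[q]`
          obtain ⟨s₁, ⟨hs₁S, hss₁⟩, -⟩ := d₀.S_transversal s hsG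
          set t : ringClassGal ι n := ⟨s, hsG⟩⁻¹ * ⟨s₁, d₀.S_subset s₁ hs₁S⟩ with ht_def
          have ht1 : (t : ringClassField K ι n ≃ₐ[ℚ] ringClassField K ι n) ∈ ringClassGalOver ι n 1 :=
            hss₁
          have htq : ∀ q ∈ n.primeFactors, R q n t = 1 := by
            intro q hq
            have hqn := Nat.dvd_of_mem_primeFactors hq
            have hRs : R q n ⟨s, hsG⟩ ∈ ringClassGal ι q :=
              restrictHom_mem_ringClassGal ι (hR q n hqn hn₀0) _
            obtain ⟨x, -, huniq⟩ := existsUnique_restrict_transversal hK ι hqn hn₀0 (hR q n hqn hn₀0)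
              d₀.S_subset d₀.S_transversal hRs
            have e1 : R q n ⟨s, hsG⟩ = x := huniq _ ⟨(hS₀' q hq _).mp (hsq q hq), by
              rw [inv_mul_cancel]; exact Subgroup.one_mem _⟩
            have e2 : R q n ⟨s₁, d₀.S_subset s₁ hs₁S⟩ = x := huniq _ ⟨⟨s₁, hs₁S, rfl⟩, by
              rw [← map_inv, ← map_mul]
              exact restrictHom_mem_ringClassGalOver hK ι hqn hn₀0 (hR q n hqn hn₀0) t ht1⟩
            rw [ht_def, map_mul, map_inv, e1, e2, inv_mul_cancel]
          have ht : t = 1 := eq_one_of_forall_restrict_prime_eq_one hK ι hd4 hn hin (fun q => R q n)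
            (fun q hq => hR q n (Nat.dvd_of_mem_primeFactors hq) hn₀0) ht1 htq
          have hss : s = s₁ := by
            rw [ht_def, inv_mul_eq_one] at ht
            exact congrArg Subtype.val ht
          rw [hss]; exact hs₁S
      · rw [← hΦ x]
        congr 1
        apply Subtype.ext
        rw [hincl' n hn₀0 x]
        exact hxy
    · simp only [d, dif_neg h]
      exact Classical.choose_spec (build n hn hin)
  refine ⟨d, hd₀, fun m n hm him hn hin hmn => ?_⟩
  have hn0 : n ≠ 0 := hn.ne_zero
  have hm0 : m ≠ 0 := hm.ne_zero
  have hle : ringClassField K ι m ≤ ringClassField K ι n := ringClassField_mono hK ι hmn hn0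
  have h1m : ringClassField K ι 1 ≤ ringClassField K ι m := ringClassField_mono hK ι (one_dvd m) hm0
  have hpf : ∀ q ∈ m.primeFactors, q ∈ n.primeFactors := fun q hq =>
    Nat.mem_primeFactors.mpr ⟨Nat.prime_of_mem_primeFactors hq,
      (Nat.dvd_of_mem_primeFactors hq).trans hmn, hn0⟩
  obtain ⟨hσn, hSn, hEn⟩ := hrec n hn hin
  obtain ⟨hσm, hSm, hEm⟩ := hrec m hm him
  -- restriction `n → m` composed with `m → q` is `n → q`
  have hcomp : ∀ q ∈ m.primeFactors, ∀ g : ringClassGal ι n,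
      R q n g = R q m ⟨R m n g, restrictHom_mem_ringClassGal ι (hR m n hmn hn0) g⟩ := fun q hq g =>
    restrictHom_comp hK ι (Nat.dvd_of_mem_primeFactors hq) hmn hn0 (hR m n hmn hn0)
      (hR q m (Nat.dvd_of_mem_primeFactors hq) hm0) (hR q n (Nat.dvd_of_mem_primeFactors (hpf q hq)) hn0) g
  refine ⟨fun q hq x x' hxx' => ?_, fun s hs => ?_, fun s' hs' => ?_, fun x x' hxx' => ?_⟩
  · -- (σ) both `R m n (σ_n q)` and `σ_m q` are the lift of `g₀ q` at level `m`
    obtain ⟨hGn, hmemn, hggn⟩ := hσn q (hpf q hq)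
    obtain ⟨hGm, hmemm, hggm⟩ := hσm q hq
    have hqp := Nat.prime_of_mem_primeFactors hq
    have hg₀mem : g₀ q ∈ ringClassGalOver ι q 1 := by
      rw [← hg₀ q hqp (him q hq)]; exact Subgroup.mem_zpowers _
    obtain ⟨z, -, huniq⟩ := existsUnique_lift_ringClassGalOver_prime hK ι hd4 hm him hq
      (hR q m (Nat.dvd_of_mem_primeFactors hq) hm0) hg₀mem
    have hr : R m n ⟨(d n hn hin).σ q, hGn⟩ ∈ ringClassGalOver ι m (m / q) :=
      ringClassGalOver_le_of_le ι m
        (ringClassField_mono hK ι (div_dvd_div_of_dvd (Nat.dvd_of_mem_primeFactors hq) hmn)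
          (div_ne_zero_of_mem_primeFactors (hpf q hq)))
        (restrictHom_mem_ringClassGalOver hK ι hmn hn0 (hR m n hmn hn0) _ hmemn)
    have e1 : (⟨R m n ⟨(d n hn hin).σ q, hGn⟩, restrictHom_mem_ringClassGal ι (hR m n hmn hn0) _⟩ :
        ringClassGal ι m) = z := huniq _ ⟨hr, by rw [← hcomp q hq]; exact hggn⟩
    have e2 : (⟨(d m hm him).σ q, hGm⟩ : ringClassGal ι m) = z := huniq _ ⟨hmemm, hggm⟩
    have e3 : R m n ⟨(d n hn hin).σ q, hGn⟩ = (d m hm him).σ q :=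
      congrArg Subtype.val (e1.trans e2.symm)
    rw [← e3]
    exact (hR m n hmn hn0 ⟨(d n hn hin).σ q, hGn⟩ x x' hxx').symm
  · -- (S, lifting) the `d n`-representative of a lift of `s` restricts to `s`
    obtain ⟨hsG, hsq⟩ := (hSm s).mp hs
    obtain ⟨g, hg⟩ := exists_restrictHom_eq hK ι hmn hn0 (hR m n hmn hn0) hsG
    obtain ⟨s', ⟨hs'S, hgs'⟩, -⟩ := (d n hn hin).S_transversal
      (g : ringClassField K ι n ≃ₐ[ℚ] ringClassField K ι n) g.2
    obtain ⟨hs'G, hs'q⟩ := (hSn s').mp hs'S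
    -- `R m n s'` satisfies the recipe at level `m` and represents the coset of `s`
    have htS : R m n ⟨s', hs'G⟩ ∈ (d m hm him).S :=
      (hSm _).mpr ⟨restrictHom_mem_ringClassGal ι (hR m n hmn hn0) _, fun q hq => by
        rw [← hcomp q hq]; exact hs'q q (hpf q hq)⟩
    have hst : s⁻¹ * R m n ⟨s', hs'G⟩ ∈ ringClassGalOver ι m 1 := by
      rw [← hg, ← map_inv, ← map_mul]
      exact restrictHom_mem_ringClassGalOver hK ι hmn hn0 (hR m n hmn hn0) _ hgs'
    obtain ⟨x, -, huniq⟩ := (d m hm him).S_transversal s hsG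
    have e1 : s = x := huniq s ⟨hs, by rw [inv_mul_cancel]; exact Subgroup.one_mem _⟩
    have e2 : R m n ⟨s', hs'G⟩ = x := huniq _ ⟨htS, hst⟩
    refine ⟨s', hs'S, fun x₁ x₁' hxx' => ?_⟩
    rw [e1, ← e2]
    exact (hR m n hmn hn0 ⟨s', hs'G⟩ x₁ x₁' hxx').symm
  · -- (S, restriction) the restriction of a representative satisfies the recipe at level `m`
    obtain ⟨hs'G, hs'q⟩ := (hSn s').mp hs'
    refine ⟨R m n ⟨s', hs'G⟩, (hSm _).mpr ⟨restrictHom_mem_ringClassGal ι (hR m n hmn hn0) _,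
      fun q hq => by rw [← hcomp q hq]; exact hs'q q (hpf q hq)⟩, fun x x' hxx' => ?_⟩
    exact (hR m n hmn hn0 ⟨s', hs'G⟩ x x' hxx').symm
  · -- (emb) both are `Φ` of the same element of `Ω`
    have hy : (x : ℂ) ∈ Ω := hmemΩ m hm0 x
    rw [hEn x' ⟨(x : ℂ), hy⟩ hxx'.symm, hEm x ⟨(x : ℂ), hy⟩ rfl]

end Summit.BirchSwinnertonDyer.BirchSwinnertonDyer.Theorems.KolyvaginDepthDoor

end
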